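import Summits.CriticalPhenomena.CardyFormulaZ2.Theorems.CardyComplexConeEdgePrecompactUFRSMixedSectors

/-!
# Touchdown data of a chain: instantiating the touchdown trichotomy
(line `qkz-strip-boundary-arm` of crux `CardyComplexCone.EdgePrecompact`, stmt-CriticalPhenomena-11387;
glue between the sector chain of the selected strand and the abstract touchdown trichotomy
`crawl_trichotomy_HT5` of `…UFRSCrawlTrichotomy.lean` — worker W-HT5 of lead c5, wave 5)

Given an orbit stretch `[lo, hi]` of `nextCorner β` from the corner `c`, a sub-chain `[i', j']`
with a NEAR end and a FAR end (either orientation), and a predicate `Fk` on indices ("the followed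
edge `cTgt (O t)` is fake": completed-open but `ω`-closed) holding at some chain index
`t ∈ [i', j')`, this file cuts the chain at its `Fk`-indices into `M + 2` fake-free pieces
`[σ l, τ l]` numbered from the near end (piece `0` extended backwards along the stretch to the
previous fake, so that it is the whole fake-free piece through the near chain end), lists the
touchdown indices `fk l` (`l ≤ M`) between consecutive pieces, and produces the real data
`μ, ν` (min / max radial distance of the vertices of a piece), `d` (radial distance of a touchdown
vertex), `ρm, ρp` (reach of the two adjacent pieces seen from the touchdown vertex) together with
the hypotheses `H1`–`H5` of `crawl_trichotomy_HT5` and the dictionary back to indices (extremal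
vertices are attained, each adjacent piece has a vertex within `1` of the touchdown vertex).
Pure bookkeeping on `ℕ` and `ℝ` (`Finset.orderEmbOfFin` sorts the fakes; `Finset.min'`/`max'`).

References: M. Aizenman, A. Burchard, Duke Math. J. 99 (1999), App. A.
(buildfix 2026-08-20: comment-only re-land to re-enqueue the module build after its blocking imports were repaired; no declaration changed.)
-/

namespace Summit.CriticalPhenomena.CardyFormulaZ2.Cruxes.EdgePrecompact.QkzStripBoundaryArm

open MeasureTheory Filter Set Metric Complex
open scoped Topology BigOperators Pointwise
open Literature.Probability.LatticeModels Literature.Probability.Percolation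
open Literature.Probability.RandomPlanarGeometry (DobrushinDomain)
open Summit.CriticalPhenomena.CardyFormulaZ2.Theses.CardyComplexCone

noncomputable section

/-! ## Sorting a finite set of indices -/

/-- **The increasing enumeration of a nonempty finite set of naturals**, as a sequence on `ℕ`
(indices `0 … M`): members, strictly increasing, exhaustive, with no member strictly between
consecutive terms. -/
theorem sortedSeq_HT5 (FS : Finset ℕ) (hne : FS.Nonempty) :
    ∃ (M : ℕ) (f : ℕ → ℕ), (∀ l ≤ M, f l ∈ FS) ∧ (∀ l l', l < l' → l' ≤ M → f l < f l') ∧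
      (∀ x ∈ FS, ∃ l ≤ M, f l = x) ∧ (∀ l, l < M → ∀ x ∈ FS, ¬ (f l < x ∧ x < f (l + 1))) ∧
      (∀ x ∈ FS, f 0 ≤ x ∧ x ≤ f M) := by
  classical
  have hcard : 0 < FS.card := Finset.card_pos.2 hne
  set k := FS.card with hk
  set emb := FS.orderEmbOfFin rfl with hemb
  set f : ℕ → ℕ := fun l => if h : l < k then emb ⟨l, h⟩ else 0 with hf
  have hfl : ∀ l (h : l < k), f l = emb ⟨l, h⟩ := fun l h => by simp only [hf, dif_pos h]
  refine ⟨k - 1, f, fun l hl => ?_, fun l l' hll' hl' => ?_, fun x hx => ?_, fun l hl x hx ⟨h1, h2⟩ => ?_, fun x hx => ?_⟩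
  · rw [hfl l (by omega)]; exact FS.orderEmbOfFin_mem rfl _
  · rw [hfl l (by omega), hfl l' (by omega)]
    exact emb.strictMono (Fin.mk_lt_mk.2 hll')
  · have : x ∈ Set.range emb := by rw [hemb, Finset.range_orderEmbOfFin]; exact hx
    obtain ⟨⟨l, hl⟩, rfl⟩ := this
    exact ⟨l, by omega, hfl l hl⟩
  · have : x ∈ Set.range emb := by rw [hemb, Finset.range_orderEmbOfFin]; exact hx
    obtain ⟨⟨l', hl'⟩, rfl⟩ := this
    rw [hfl l (by omega)] at h1
    rw [hfl (l + 1) (by omega)] at h2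
    have h1' : (⟨l, by omega⟩ : Fin k) < ⟨l', hl'⟩ := emb.lt_iff_lt.1 h1
    have h2' : (⟨l', hl'⟩ : Fin k) < ⟨l + 1, by omega⟩ := emb.lt_iff_lt.1 h2
    rw [Fin.mk_lt_mk] at h1' h2'
    omega
  · have : x ∈ Set.range emb := by rw [hemb, Finset.range_orderEmbOfFin]; exact hx
    obtain ⟨⟨l', hl'⟩, rfl⟩ := this
    rw [hfl 0 hcard, hfl (k - 1) (by omega)]
    exact ⟨emb.monotone (Fin.mk_le_mk.2 (Nat.zero_le _)), emb.monotone (Fin.mk_le_mk.2 (by omega))⟩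

/-! ## Extremal values over an index interval -/

/-- Minimum and maximum of a real function over a nonempty integer interval are attained. -/
theorem exists_min_max_Icc_HT5 (g : ℕ → ℝ) {a b : ℕ} (hab : a ≤ b) :
    ∃ mn mx : ℝ, (∀ t, a ≤ t → t ≤ b → mn ≤ g t ∧ g t ≤ mx) ∧
      (∃ t, a ≤ t ∧ t ≤ b ∧ g t = mn) ∧ (∃ t, a ≤ t ∧ t ≤ b ∧ g t = mx) := by
  classical
  have hne : (Finset.Icc a b).Nonempty := ⟨a, Finset.mem_Icc.2 ⟨le_rfl, hab⟩⟩
  obtain ⟨t₁, ht₁, hmin⟩ := Finset.exists_min_image (Finset.Icc a b) g hne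
  obtain ⟨t₂, ht₂, hmax⟩ := Finset.exists_max_image (Finset.Icc a b) g hne
  rw [Finset.mem_Icc] at ht₁ ht₂
  exact ⟨g t₁, g t₂, fun t h1 h2 => ⟨hmin t (Finset.mem_Icc.2 ⟨h1, h2⟩), hmax t (Finset.mem_Icc.2 ⟨h1, h2⟩)⟩,
    ⟨t₁, ht₁.1, ht₁.2, rfl⟩, ⟨t₂, ht₂.1, ht₂.2, rfl⟩⟩

/-! ## The real data of a piece decomposition -/

/-- **The real data of a piece decomposition and the hypotheses `H1`–`H3` of the touchdown
trichotomy.** Pieces are index intervals `[σ l, τ l]`, `fk l` is the touchdown index between piece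
`l` and piece `l + 1`, each of the two adjacent pieces having a vertex within `1` of the touchdown
vertex; `μ, ν` are the attained min / max radial distances of a piece, `d` the radial distance of
the touchdown vertex, `ρm, ρp` the attained reaches of the two adjacent pieces from it. -/
theorem crawl_reals_HT5 (β : BondConfig (Site 2)) (c : Site 2 × Fin 4) (z' : ℂ) (M : ℕ) (σ τ fk : ℕ → ℕ)
    (hστ : ∀ l, σ l ≤ τ l)
    (hnear₁ : ∀ l ≤ M, ∃ t, σ l ≤ t ∧ t ≤ τ l ∧
      dist (Site.toComplex (cornerOrbit β c t).1) (Site.toComplex (cornerOrbit β c (fk l)).1) ≤ 1)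
    (hnear₂ : ∀ l ≤ M, ∃ t, σ (l + 1) ≤ t ∧ t ≤ τ (l + 1) ∧
      dist (Site.toComplex (cornerOrbit β c t).1) (Site.toComplex (cornerOrbit β c (fk l)).1) ≤ 1) :
    ∃ (μ ν d ρm ρp : ℕ → ℝ),
      (∀ l, d l = dist (Site.toComplex (cornerOrbit β c (fk l)).1) z') ∧
      (∀ l, (∀ t, σ l ≤ t → t ≤ τ l → μ l ≤ dist (Site.toComplex (cornerOrbit β c t).1) z' ∧
          dist (Site.toComplex (cornerOrbit β c t).1) z' ≤ ν l) ∧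
        (∃ t, σ l ≤ t ∧ t ≤ τ l ∧ dist (Site.toComplex (cornerOrbit β c t).1) z' = μ l) ∧
        (∃ t, σ l ≤ t ∧ t ≤ τ l ∧ dist (Site.toComplex (cornerOrbit β c t).1) z' = ν l)) ∧
      (∀ l, (∀ t, σ l ≤ t → t ≤ τ l →
          dist (Site.toComplex (cornerOrbit β c t).1) (Site.toComplex (cornerOrbit β c (fk l)).1) ≤ ρm l) ∧
        (∃ t, σ l ≤ t ∧ t ≤ τ l ∧
          dist (Site.toComplex (cornerOrbit β c t).1) (Site.toComplex (cornerOrbit β c (fk l)).1) = ρm l) ∧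
        (∀ t, σ (l + 1) ≤ t → t ≤ τ (l + 1) →
          dist (Site.toComplex (cornerOrbit β c t).1) (Site.toComplex (cornerOrbit β c (fk l)).1) ≤ ρp l) ∧
        (∃ t, σ (l + 1) ≤ t ∧ t ≤ τ (l + 1) ∧
          dist (Site.toComplex (cornerOrbit β c t).1) (Site.toComplex (cornerOrbit β c (fk l)).1) = ρp l)) ∧
      (∀ l ≤ M, μ l ≤ d l + 1 ∧ d l - 1 ≤ ν l) ∧
      (∀ l ≤ M, μ (l + 1) ≤ d l + 1 ∧ d l - 1 ≤ ν (l + 1)) ∧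
      (∀ l ≤ M, d l - μ l ≤ ρm l ∧ ν l - d l ≤ ρm l ∧ d l - μ (l + 1) ≤ ρp l ∧ ν (l + 1) - d l ≤ ρp l) := by
  set v : ℕ → ℂ := fun t => Site.toComplex (cornerOrbit β c t).1 with hv
  have hrad := fun l => exists_min_max_Icc_HT5 (fun t => dist (v t) z') (hστ l)
  choose μ ν hμν hμat hνat using hrad
  have hrm := fun l => exists_min_max_Icc_HT5 (fun t => dist (v t) (v (fk l))) (hστ l)
  choose _lm ρm hρm _hlmat hρmat using hrm
  have hrp := fun l => exists_min_max_Icc_HT5 (fun t => dist (v t) (v (fk l))) (hστ (l + 1))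
  choose _lp ρp hρp _hlpat hρpat using hrp
  refine ⟨μ, ν, fun l => dist (v (fk l)) z', ρm, ρp, fun l => rfl,
    fun l => ⟨fun t h1 h2 => hμν l t h1 h2, hμat l, hνat l⟩,
    fun l => ⟨fun t h1 h2 => (hρm l t h1 h2).2, hρmat l, fun t h1 h2 => (hρp l t h1 h2).2, hρpat l⟩,
    fun l hl => ?_, fun l hl => ?_, fun l hl => ?_⟩
  · obtain ⟨t, h1, h2, h3⟩ := hnear₁ l hl
    have h4 := hμν l t h1 h2
    have h5 := dist_triangle (v t) (v (fk l)) z'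
    have h6 := dist_triangle (v (fk l)) (v t) z'
    rw [dist_comm (v (fk l)) (v t)] at h6
    exact ⟨by linarith [h4.1], by linarith [h4.2]⟩
  · obtain ⟨t, h1, h2, h3⟩ := hnear₂ l hl
    have h4 := hμν (l + 1) t h1 h2
    have h5 := dist_triangle (v t) (v (fk l)) z'
    have h6 := dist_triangle (v (fk l)) (v t) z'
    rw [dist_comm (v (fk l)) (v t)] at h6
    exact ⟨by linarith [h4.1], by linarith [h4.2]⟩
  · obtain ⟨t₁, h11, h12, h13⟩ := hμat l
    obtain ⟨t₂, h21, h22, h23⟩ := hνat l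
    obtain ⟨t₃, h31, h32, h33⟩ := hμat (l + 1)
    obtain ⟨t₄, h41, h42, h43⟩ := hνat (l + 1)
    have e1 := (hρm l t₁ h11 h12).2
    have e2 := (hρm l t₂ h21 h22).2
    have e3 := (hρp l t₃ h31 h32).2
    have e4 := (hρp l t₄ h41 h42).2
    have tri : ∀ t, dist (v (fk l)) z' ≤ dist (v t) (v (fk l)) + dist (v t) z' ∧
        dist (v t) z' ≤ dist (v t) (v (fk l)) + dist (v (fk l)) z' := fun t =>
      ⟨by have := dist_triangle (v (fk l)) (v t) z'; rwa [dist_comm (v (fk l)) (v t)] at this, dist_triangle _ _ _⟩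
    refine ⟨?_, ?_, ?_, ?_⟩
    · have := (tri t₁).1; rw [h13] at this; linarith
    · have := (tri t₂).2; rw [h23] at this; linarith
    · have := (tri t₃).1; rw [h33] at this; linarith
    · have := (tri t₄).2; rw [h43] at this; linarith


/-! ## The piece decomposition of a chain -/

/-- **The structural data of the piece decomposition** (index level): the chain-fakes of
`[i', j')` sorted, the pieces numbered from the near end (piece `0` extended along the stretch to
the neighbouring fake beyond the near chain end), fake-free, the near chain end in piece `0`, the
far chain end in piece `M + 1`, each touchdown index adjacent to both neighbouring pieces. -/
theorem crawl_pieces_HT5 (lo hi i' j' near far : ℕ) (Fk : ℕ → Prop) (hlo : lo ≤ i') (hhi : j' ≤ hi)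
    (hnf : (i' = near ∧ j' = far) ∨ (j' = near ∧ i' = far)) (hne : ∃ t, i' ≤ t ∧ t < j' ∧ Fk t) :
    ∃ (M : ℕ) (σ τ fk : ℕ → ℕ),
      (∀ l, lo ≤ σ l ∧ σ l ≤ τ l ∧ τ l ≤ hi) ∧
      (∀ l ≤ M + 1, ∀ t, σ l ≤ t → t < τ l → ¬ Fk t) ∧
      (∀ l ≤ M, i' ≤ fk l ∧ fk l < j' ∧ Fk (fk l)) ∧
      (σ 0 ≤ near ∧ near ≤ τ 0 ∧ σ (M + 1) ≤ far ∧ far ≤ τ (M + 1)) ∧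
      (∀ l ≤ M, (σ l ≤ fk l ∧ fk l ≤ τ l ∧ σ (l + 1) ≤ fk l + 1 ∧ fk l + 1 ≤ τ (l + 1)) ∨
        (σ l ≤ fk l + 1 ∧ fk l + 1 ≤ τ l ∧ σ (l + 1) ≤ fk l ∧ fk l ≤ τ (l + 1))) := by
  classical
  set FS : Finset ℕ := (Finset.Ico i' j').filter Fk with hFS
  have hmemFS : ∀ {t}, t ∈ FS ↔ i' ≤ t ∧ t < j' ∧ Fk t := by
    intro t; rw [hFS, Finset.mem_filter, Finset.mem_Ico, and_assoc]
  have hFSne : FS.Nonempty := by obtain ⟨t, h1, h2, h3⟩ := hne; exact ⟨t, hmemFS.2 ⟨h1, h2, h3⟩⟩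
  obtain ⟨M, f, hfmem, hfmono, hfex, hfgap, hfbd⟩ := sortedSeq_HT5 FS hFSne
  have hf : ∀ l ≤ M, i' ≤ f l ∧ f l < j' ∧ Fk (f l) := fun l hl => hmemFS.1 (hfmem l hl)
  have hgap : ∀ l, l < M → ∀ t, f l < t → t < f (l + 1) → ¬ Fk t := by
    intro l hl t h1 h2 ht
    have h3 := hf l hl.le; have h4 := hf (l + 1) (by omega)
    exact hfgap l hl t (hmemFS.2 ⟨by omega, by omega, ht⟩) ⟨h1, h2⟩
  have hf0 := hf 0 (Nat.zero_le _)
  have hfM := hf M le_rfl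
  have hbefore : ∀ t, i' ≤ t → t < f 0 → ¬ Fk t := by
    intro t h1 h2 ht
    have := (hfbd t (hmemFS.2 ⟨h1, by omega, ht⟩)).1; omega
  have hafter : ∀ t, f M < t → t < j' → ¬ Fk t := by
    intro t h1 h2 ht
    have := (hfbd t (hmemFS.2 ⟨by omega, h2, ht⟩)).2; omega
  -- the previous fake on the stretch before the chain
  set PS : Finset ℕ := (Finset.Ico lo i').filter Fk with hPS
  have hprev : ∃ pv, lo ≤ pv ∧ pv ≤ i' ∧ ∀ t, pv ≤ t → t < i' → ¬ Fk t := by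
    by_cases hP : PS.Nonempty
    · set mx := PS.max' hP with hmx
      have hm : mx ∈ PS := Finset.max'_mem PS hP
      rw [hPS, Finset.mem_filter, Finset.mem_Ico] at hm
      refine ⟨mx + 1, by omega, by omega, fun t h1 h2 ht => ?_⟩
      have hmem : t ∈ PS := by rw [hPS, Finset.mem_filter, Finset.mem_Ico]; exact ⟨⟨by omega, h2⟩, ht⟩
      have := PS.le_max' t hmem; rw [← hmx] at this; omega
    · refine ⟨lo, le_rfl, hlo, fun t h1 h2 ht => hP ⟨t, ?_⟩⟩
      rw [hPS, Finset.mem_filter, Finset.mem_Ico]; exact ⟨⟨h1, h2⟩, ht⟩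
  obtain ⟨pv, hpv1, hpv2, hpv3⟩ := hprev
  -- the next fake on the stretch after the last chain-fake
  set NS : Finset ℕ := (Finset.Ioo (f M) hi).filter Fk with hNS
  have hnext : ∃ nx, f M < nx ∧ nx ≤ hi ∧ j' ≤ nx ∧ ∀ t, f M < t → t < nx → ¬ Fk t := by
    by_cases hN : NS.Nonempty
    · set mn := NS.min' hN with hmn
      have hm : mn ∈ NS := Finset.min'_mem NS hN
      rw [hNS, Finset.mem_filter, Finset.mem_Ioo] at hm
      refine ⟨mn, hm.1.1, hm.1.2.le, ?_, fun t h1 h2 ht => ?_⟩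
      · by_contra hc; push Not at hc
        exact hafter _ hm.1.1 hc hm.2
      · have hmem : t ∈ NS := by
          rw [hNS, Finset.mem_filter, Finset.mem_Ioo]; exact ⟨⟨h1, by omega⟩, ht⟩
        have := NS.min'_le t hmem; rw [← hmn] at this; omega
    · refine ⟨hi, by omega, le_rfl, hhi, fun t h1 h2 ht => hN ⟨t, ?_⟩⟩
      rw [hNS, Finset.mem_filter, Finset.mem_Ioo]; exact ⟨⟨h1, h2⟩, ht⟩
  obtain ⟨nx, hnx1, hnx2, hnx3, hnx4⟩ := hnext
  rcases hnf with ⟨rfl, rfl⟩ | ⟨rfl, rfl⟩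
  · -- forward: piece 0 = [pv, f 0], piece l = [f (l-1) + 1, f l], piece M+1 = [f M + 1, j']
    set σ : ℕ → ℕ := fun l => if l = 0 then pv else if l ≤ M + 1 then f (l - 1) + 1 else lo with hσ
    set τ : ℕ → ℕ := fun l => if l ≤ M then f l else if l = M + 1 then j' else lo with hτ
    have eσ0 : σ 0 = pv := by simp [hσ]
    have eσ : ∀ l, 1 ≤ l → l ≤ M + 1 → σ l = f (l - 1) + 1 := fun l h1 h2 => by
      simp [hσ, show l ≠ 0 by omega, h2]
    have eσ' : ∀ l, M + 1 < l → σ l = lo := fun l h1 => by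
      simp [hσ, show l ≠ 0 by omega, show ¬ l ≤ M + 1 by omega]
    have eτ : ∀ l ≤ M, τ l = f l := fun l h1 => by simp [hτ, h1]
    have eτM : τ (M + 1) = j' := by simp [hτ]
    have eτ' : ∀ l, M + 1 < l → τ l = lo := fun l h1 => by
      simp [hτ, show ¬ l ≤ M by omega, show l ≠ M + 1 by omega]
    refine ⟨M, σ, τ, f, fun l => ?_, fun l hl t h1 h2 => ?_, hf, ?_, fun l hl => Or.inl ?_⟩
    · rcases Nat.lt_or_ge (M + 1) l with h | h
      · rw [eσ' l h, eτ' l h]; omega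
      · rcases Nat.eq_zero_or_pos l with rfl | hpos
        · rw [eσ0, eτ 0 (Nat.zero_le _)]; omega
        · rw [eσ l hpos h]
          rcases Nat.lt_or_ge M l with h' | h'
          · rw [show l = M + 1 by omega, eτM, show M + 1 - 1 = M by omega]; omega
          · rw [eτ l h']
            have := hfmono (l - 1) l (by omega) h'; have := hf (l - 1) (by omega); have := hf l h'; omega
    · rcases Nat.eq_zero_or_pos l with rfl | hpos
      · rw [eσ0] at h1; rw [eτ 0 (Nat.zero_le _)] at h2
        rcases Nat.lt_or_ge t i' with h3 | h3
        · exact hpv3 t h1 h3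
        · exact hbefore t h3 h2
      · rw [eσ l hpos hl] at h1
        rcases Nat.lt_or_ge M l with h' | h'
        · rw [show l = M + 1 by omega, eτM] at h2
          exact hafter t (by rw [show l = M + 1 by omega, show M + 1 - 1 = M by omega] at h1; omega) h2
        · rw [eτ l h'] at h2
          exact hgap (l - 1) (by omega) t (by omega) (by rw [show l - 1 + 1 = l by omega]; exact h2)
    · rw [eσ0, eτ 0 (Nat.zero_le _), eσ (M + 1) (by omega) le_rfl, eτM, show M + 1 - 1 = M by omega]
      omega
    · rw [eτ l hl, eσ (l + 1) (by omega) (by omega), show l + 1 - 1 = l by omega]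
      refine ⟨?_, le_rfl, le_rfl, ?_⟩
      · rcases Nat.eq_zero_or_pos l with rfl | hpos
        · rw [eσ0]; omega
        · rw [eσ l hpos (by omega)]; have := hfmono (l - 1) l (by omega) hl; omega
      · rcases Nat.lt_or_ge l M with h3 | h3
        · rw [eτ (l + 1) (by omega)]; have := hfmono l (l + 1) (by omega) (by omega); omega
        · rw [show l = M by omega, eτM]; omega
  · -- backward: piece 0 = [f M + 1, nx], piece l = [f (M - l) + 1, f (M + 1 - l)], piece M+1 = [pv, f 0]
    set σ : ℕ → ℕ := fun l => if l ≤ M then f (M - l) + 1 else if l = M + 1 then pv else lo with hσ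
    set τ : ℕ → ℕ := fun l => if l = 0 then nx else if l ≤ M + 1 then f (M + 1 - l) else lo with hτ
    have eσ : ∀ l ≤ M, σ l = f (M - l) + 1 := fun l h1 => by simp [hσ, h1]
    have eσM : σ (M + 1) = pv := by simp [hσ]
    have eσ' : ∀ l, M + 1 < l → σ l = lo := fun l h1 => by
      simp [hσ, show ¬ l ≤ M by omega, show l ≠ M + 1 by omega]
    have eτ0 : τ 0 = nx := by simp [hτ]
    have eτ : ∀ l, 1 ≤ l → l ≤ M + 1 → τ l = f (M + 1 - l) := fun l h1 h2 => by
      simp [hτ, show l ≠ 0 by omega, h2]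
    have eτ' : ∀ l, M + 1 < l → τ l = lo := fun l h1 => by
      simp [hτ, show l ≠ 0 by omega, show ¬ l ≤ M + 1 by omega]
    refine ⟨M, σ, τ, fun l => f (M - l), fun l => ?_, fun l hl t h1 h2 => ?_, fun l hl => hf (M - l) (by omega), ?_,
      fun l hl => Or.inr ?_⟩
    · rcases Nat.lt_or_ge (M + 1) l with h | h
      · rw [eσ' l h, eτ' l h]; omega
      · rcases Nat.lt_or_ge M l with h' | h'
        · rw [show l = M + 1 by omega, eσM, eτ (M + 1) (by omega) le_rfl, show M + 1 - (M + 1) = 0 by omega]; omega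
        · rw [eσ l h']
          rcases Nat.eq_zero_or_pos l with rfl | hpos
          · rw [eτ0, Nat.sub_zero]; omega
          · rw [eτ l hpos h]
            have := hfmono (M - l) (M + 1 - l) (by omega) (by omega); have := hf (M - l) (by omega)
            have := hf (M + 1 - l) (by omega); omega
    · rcases Nat.lt_or_ge M l with h' | h'
      · rw [show l = M + 1 by omega, eσM] at h1
        rw [show l = M + 1 by omega, eτ (M + 1) (by omega) le_rfl, show M + 1 - (M + 1) = 0 by omega] at h2
        rcases Nat.lt_or_ge t i' with h5 | h5
        · exact hpv3 t h1 h5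
        · exact hbefore t h5 h2
      · rw [eσ l h'] at h1
        rcases Nat.eq_zero_or_pos l with rfl | hpos
        · rw [eτ0] at h2; rw [Nat.sub_zero] at h1
          exact hnx4 t (by omega) h2
        · rw [eτ l hpos hl] at h2
          exact hgap (M - l) (by omega) t (by omega) (by rw [show M - l + 1 = M + 1 - l by omega]; exact h2)
    · rw [eσ 0 (Nat.zero_le _), Nat.sub_zero, eτ0, eσM, eτ (M + 1) (by omega) le_rfl, show M + 1 - (M + 1) = 0 by omega]
      omega
    · beta_reduce
      rw [eσ l hl, eτ (l + 1) (by omega) (by omega), show M + 1 - (l + 1) = M - l by omega]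
      refine ⟨le_rfl, ?_, ?_, le_rfl⟩
      · rcases Nat.eq_zero_or_pos l with rfl | hpos
        · rw [eτ0, Nat.sub_zero]; omega
        · rw [eτ l hpos (by omega)]
          have := hfmono (M - l) (M + 1 - l) (by omega) (by omega); omega
      · rcases Nat.lt_or_ge l M with h3 | h3
        · rw [eσ (l + 1) (by omega)]; have := hfmono (M - (l + 1)) (M - l) (by omega) (by omega); omega
        · rw [show l = M by omega, eσM, Nat.sub_self]; omega

/-! ## The touchdown data of a chain -/

/-- **The touchdown data of a chain** (the instantiation of `crawl_trichotomy_HT5`): pieces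
`[σ l, τ l]` (`l ≤ M + 1`, fake-free, inside the stretch `[lo, hi]`, the near chain end in piece
`0`, the far one in piece `M + 1`), touchdown indices `fk l` (chain-fakes), reals `μ ν d ρm ρp`
with their dictionary (attained extremal vertices; each adjacent piece has a vertex within `1` of
the touchdown vertex) and the hypotheses `H1`–`H3` of the trichotomy; `H4` / `H5` follow from the
dictionary at the near / far chain end. -/
theorem crawl_data_HT5 (β : BondConfig (Site 2)) (c : Site 2 × Fin 4) (z' : ℂ) (lo hi i' j' near far : ℕ)
    (Fk : ℕ → Prop) (hlo : lo ≤ i') (hhi : j' ≤ hi)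
    (hnf : (i' = near ∧ j' = far) ∨ (j' = near ∧ i' = far)) (hne : ∃ t, i' ≤ t ∧ t < j' ∧ Fk t) :
    ∃ (M : ℕ) (σ τ fk : ℕ → ℕ) (μ ν d ρm ρp : ℕ → ℝ),
      (∀ l, lo ≤ σ l ∧ σ l ≤ τ l ∧ τ l ≤ hi) ∧
      (∀ l ≤ M + 1, ∀ t, σ l ≤ t → t < τ l → ¬ Fk t) ∧
      (∀ l ≤ M, i' ≤ fk l ∧ fk l < j' ∧ Fk (fk l)) ∧
      (σ 0 ≤ near ∧ near ≤ τ 0 ∧ σ (M + 1) ≤ far ∧ far ≤ τ (M + 1)) ∧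
      (∀ l ≤ M, (∃ t, σ l ≤ t ∧ t ≤ τ l ∧
          dist (Site.toComplex (cornerOrbit β c t).1) (Site.toComplex (cornerOrbit β c (fk l)).1) ≤ 1) ∧
        (∃ t, σ (l + 1) ≤ t ∧ t ≤ τ (l + 1) ∧
          dist (Site.toComplex (cornerOrbit β c t).1) (Site.toComplex (cornerOrbit β c (fk l)).1) ≤ 1)) ∧
      (∀ l, d l = dist (Site.toComplex (cornerOrbit β c (fk l)).1) z') ∧
      (∀ l, (∀ t, σ l ≤ t → t ≤ τ l → μ l ≤ dist (Site.toComplex (cornerOrbit β c t).1) z' ∧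
          dist (Site.toComplex (cornerOrbit β c t).1) z' ≤ ν l) ∧
        (∃ t, σ l ≤ t ∧ t ≤ τ l ∧ dist (Site.toComplex (cornerOrbit β c t).1) z' = μ l) ∧
        (∃ t, σ l ≤ t ∧ t ≤ τ l ∧ dist (Site.toComplex (cornerOrbit β c t).1) z' = ν l)) ∧
      (∀ l, (∀ t, σ l ≤ t → t ≤ τ l →
          dist (Site.toComplex (cornerOrbit β c t).1) (Site.toComplex (cornerOrbit β c (fk l)).1) ≤ ρm l) ∧
        (∃ t, σ l ≤ t ∧ t ≤ τ l ∧
          dist (Site.toComplex (cornerOrbit β c t).1) (Site.toComplex (cornerOrbit β c (fk l)).1) = ρm l) ∧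
        (∀ t, σ (l + 1) ≤ t → t ≤ τ (l + 1) →
          dist (Site.toComplex (cornerOrbit β c t).1) (Site.toComplex (cornerOrbit β c (fk l)).1) ≤ ρp l) ∧
        (∃ t, σ (l + 1) ≤ t ∧ t ≤ τ (l + 1) ∧
          dist (Site.toComplex (cornerOrbit β c t).1) (Site.toComplex (cornerOrbit β c (fk l)).1) = ρp l)) ∧
      (∀ l ≤ M, μ l ≤ d l + 1 ∧ d l - 1 ≤ ν l) ∧
      (∀ l ≤ M, μ (l + 1) ≤ d l + 1 ∧ d l - 1 ≤ ν (l + 1)) ∧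
      (∀ l ≤ M, d l - μ l ≤ ρm l ∧ ν l - d l ≤ ρm l ∧ d l - μ (l + 1) ≤ ρp l ∧ ν (l + 1) - d l ≤ ρp l) := by
  obtain ⟨M, σ, τ, fk, hστ, hfree, hfk, hends, hadjp⟩ := crawl_pieces_HT5 lo hi i' j' near far Fk hlo hhi hnf hne
  have hnear : ∀ l ≤ M, (∃ t, σ l ≤ t ∧ t ≤ τ l ∧
        dist (Site.toComplex (cornerOrbit β c t).1) (Site.toComplex (cornerOrbit β c (fk l)).1) ≤ 1) ∧
      (∃ t, σ (l + 1) ≤ t ∧ t ≤ τ (l + 1) ∧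
        dist (Site.toComplex (cornerOrbit β c t).1) (Site.toComplex (cornerOrbit β c (fk l)).1) ≤ 1) := by
    intro l hl
    have h0 : dist (Site.toComplex (cornerOrbit β c (fk l)).1) (Site.toComplex (cornerOrbit β c (fk l)).1) ≤ 1 := by
      rw [dist_self]; norm_num
    have h1 := dist_vertex_succ_le β c (fk l)
    rcases hadjp l hl with ⟨a1, a2, a3, a4⟩ | ⟨a1, a2, a3, a4⟩
    · exact ⟨⟨fk l, a1, a2, h0⟩, ⟨fk l + 1, a3, a4, h1⟩⟩
    · exact ⟨⟨fk l + 1, a1, a2, h1⟩, ⟨fk l, a3, a4, h0⟩⟩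
  obtain ⟨μ, ν, d, ρm, ρp, hd, hrad, hreach, H1, H2, H3⟩ :=
    crawl_reals_HT5 β c z' M σ τ fk (fun l => (hστ l).2.1) (fun l hl => (hnear l hl).1) (fun l hl => (hnear l hl).2)
  exact ⟨M, σ, τ, fk, μ, ν, d, ρm, ρp, hστ, hfree, hfk, hends, hnear, hd, hrad, hreach, H1, H2, H3⟩


/-- **The touchdown data of a chain** (registered anchor `ufrs_crawlData` of stmt-CriticalPhenomena-11387;
`crawl_data_HT5` with all binders explicit). -/
theorem ufrs_crawlData : ∀ (β : BondConfig (Site 2)) (c : Site 2 × Fin 4) (z' : ℂ) (lo hi i' j' near far : ℕ) (Fk : ℕ → Prop), lo ≤ i' → j' ≤ hi → ((i' = near ∧ j' = far) ∨ (j' = near ∧ i' = far)) → (∃ t, i' ≤ t ∧ t < j' ∧ Fk t) → ∃ (M : ℕ) (σ τ fk : ℕ → ℕ) (μ ν d ρm ρp : ℕ → ℝ), (∀ l, lo ≤ σ l ∧ σ l ≤ τ l ∧ τ l ≤ hi) ∧ (∀ l ≤ M + 1, ∀ t, σ l ≤ t → t < τ l → ¬ Fk t) ∧ (∀ l ≤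 M, i' ≤ fk l ∧ fk l < j' ∧ Fk (fk l)) ∧ (σ 0 ≤ near ∧ near ≤ τ 0 ∧ σ (M + 1) ≤ far ∧ far ≤ τ (M + 1)) ∧ (∀ l ≤ M, (∃ t, σ l ≤ t ∧ t ≤ τ l ∧ dist (Site.toComplex (cornerOrbit β c t).1) (Site.toComplex (cornerOrbit β c (fk l)).1) ≤ 1) ∧ (∃ t, σ (l + 1) ≤ t ∧ t ≤ τ (l + 1) ∧ dist (Site.toComplex (cornerOrbit β c t).1) (Site.toComplex (cornerOrbit β c (fk l)).1) ≤ 1)) ∧ (∀ l, d l = dist (Site.toComplex (cornerOrbit β c (fk l)).1) z') ∧ (∀ l, (∀ t, σ l ≤ t → t ≤ τ l → μ l ≤ dist (Site.toComplex (cornerOrbit β c t).1) z' ∧ dist (Site.toComplex (cornerOrbit β c t).1) z' ≤ ν l) ∧ (∃ t, σ l ≤ t ∧ t ≤ τ l ∧ dist (Site.toComplex (cornerOrbit β c t).1) z' = μ l) ∧ (∃ t, σ l ≤ t ∧ t ≤ τ l ∧ dist (Site.toComplex (cornerOrbit β c t).1) z' = ν l)) ∧ (∀ l, (∀ t, σ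 l ≤ t → t ≤ τ l → dist (Site.toComplex (cornerOrbit β c t).1) (Site.toComplex (cornerOrbit β c (fk l)).1) ≤ ρm l) ∧ (∃ t, σ l ≤ t ∧ t ≤ τ l ∧ dist (Site.toComplex (cornerOrbit β c t).1) (Site.toComplex (cornerOrbit β c (fk l)).1) = ρm l) ∧ (∀ t, σ (l + 1) ≤ t → t ≤ τ (l + 1) → dist (Site.toComplex (cornerOrbit β c t).1) (Site.toComplex (cornerOrbit β c (fk l)).1) ≤ ρp l) ∧ (∃ t, σ (l + 1) ≤ t ∧ t ≤ τ (l + 1) ∧ dist (Site.toComplex (cornerOrbit β c t).1) (Site.toComplex (cornerOrbit β c (fk l)).1) = ρp l)) ∧ (∀ l ≤ M, μ l ≤ d l + 1 ∧ d l - 1 ≤ ν l) ∧ (∀ l ≤ M, μ (l + 1) ≤ d l + 1 ∧ d l - 1 ≤ ν (l + 1)) ∧ (∀ l ≤ M, d l - μ l ≤ ρm l ∧ ν l - d l ≤ ρm l ∧ d l - μ (l + 1) ≤ ρp l ∧ ν (l + 1) - d l ≤ ρp l) :=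
  fun β c z' lo hi i' j' near far Fk hlo hhi hnf hne => crawl_data_HT5 β c z' lo hi i' j' near far Fk hlo hhi hnf hne

end

end Summit.CriticalPhenomena.CardyFormulaZ2.Cruxes.EdgePrecompact.QkzStripBoundaryArm
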